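import Mathlib.Topology.Algebra.InfiniteSum.Constructions
import Mathlib.Topology.Algebra.InfiniteSum.Order
import Mathlib.Analysis.SpecialFunctions.Log.Basic
import Literature.MathematicalPhysics.StatisticalMechanics.Theil2006EnergyBounds
import HarnessLib

/-!
# Theil 2006, §2.3 (21)–(22): the distance set `Λ` of `A₂`, the multiplicities `m(λ)`, and the
shell formula `V_*(s) = Σ_{λ ∈ Λ} m(λ) V(λ s)`; the weight estimate (35)

Topic: `Literature/MathematicalPhysics/StatisticalMechanics`; companion to `Theil2006.lean`
(F. Theil, *A proof of crystallization in two dimensions*, Comm. Math. Phys. **262** (2006)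
209–236; read in the author's accepted preprint of 26 Aug 2005, identical numbering, pp. 8, 11).
Everything here is PROVED; no named fact is added or discharged. The definitions `m(λ)`, `Λ` are
the bookkeeping of §§2.3–2.4 by which sums over the dilated lattice `s A₂` are regrouped by
distance ("shells"); (22) is the regrouped form of the renormalized potential
`V_*(r) = ⅙ Σ_{ξ ∈ A₂∖{0}} V(r|ξ|)` (`Theil2006.renormalizedPotential`), used at (36)→(37), and (35)
is the summability of the weights that makes the error terms of (32)–(34) uniformly bounded.

## The printed text (preprint p. 8, verbatim)

> For each `λ ∈ ℝ` we define `m(λ) ∈ ℕ` to be the number of different `D₆`-invariant sub-lattices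
> of `A₂` with lattice parameter `λ` divided by `λ²` e.g. `m(1) = 1`, `m(√7) = 2`. The variable `m(λ)`
> is introduced for bookkeeping purposes only, it appears in intermediate expressions but is never
> evaluated or estimated explicitly. A simple geometric consideration shows that
> (21) `m(λ) = ⅙ #(A₂ ∩ {|η| = λ}) = ⅙ #{k ∈ ℤ² | k · (2 1; 1 2) k = 2λ²}`.
> The countable set `Λ = {λ > 0 | m(λ) ≠ 0}` is the set of distances. With this definition we
> obtain an equivalent formula for the renormalized potential:
> (22) `V_*(s) = Σ_{λ ∈ Λ} m(λ) V(λ s)`.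

and (p. 11) "The error terms terms which appear in (32), (33) and (34) can be bounded uniformly
(35) `Σ_{λ ∈ Λ∖{1}} ((1 + log(λ)) λ⁻⁵ + λ⁻³) m(λ) ≤ C Σ_{k ∈ ℤ²∖{0}} (k · (2 1; 1 2) k)^{-3/2} < ∞`."

## Content and rendering

* `Theil2006.shell λ = {k ≠ 0 : |triPoint k| = λ}` — the lattice points `A₂ ∖ {0}` at distance `λ`
  (in `ℤ²`-labels, `triPoint k = k₁ b₁ + k₂ b₂`), a finite set (`shell_finite`); the origin is left
  out so that (21) defines an integer for every `λ` (with `0 ∈ A₂` counted, (21) would read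
  `m(0) = ⅙`; the paper only uses `λ > 0`).
* `Theil2006.m λ = #shell(λ) / 6` — **(21), first form, as the definition**; `six_mul_m`:
  `6 m(λ) = #shell(λ)` (the "simple geometric consideration": the rotation by `π/3`,
  `(k₁, k₂) ↦ (-k₂, k₁ + k₂)` in labels, and its powers `rotN j` act freely on `A₂ ∖ {0}` with the
  sector `{k₁ ≥ 1, k₂ ≥ 0}` as a fundamental domain, `m_eq_card_sector`); **(21), second form**:
  `shell_eq_quadForm` (`λ > 0`): `shell(λ) = {k ∈ ℤ² | k · (2 1; 1 2) k = 2λ²}`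
  (`quadForm k = ![k₁,k₂] ⬝ᵥ (!![2,1;1,2] *ᵥ ![k₁,k₂]) = 2(k₁² + k₁k₂ + k₂²) = 2|triPoint k|²`);
  the printed examples `m_one : m 1 = 1`, `m_sqrt_seven : m √7 = 2`.
* `Theil2006.distSet = {λ > 0 | m(λ) ≠ 0}` — **`Λ` as printed**; `mem_distSet_iff`: "`Λ` is the set
  of distances", `λ ∈ Λ ↔ ∃ ξ ∈ A₂ ∖ {0}, |ξ| = λ`; countable (`distSet_countable`), `⊂ [1, ∞)`,
  `1 ∈ Λ`, `Λ ∖ {1} ⊂ [√3, ∞)`.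
* `Theil2006.hasSum_shells` — regrouping by shells: if `Σ_{ξ ∈ A₂∖{0}} F(|ξ|)` converges
  (unconditionally, as all sums here) to `a`, then `Σ_{λ ∈ Λ} 6 m(λ) F(λ) = a`.
* `Theil2006.IsNormalized.hasSum_renormalizedPotential`, `…renormalizedPotential_eq_tsum` —
  **(22)**: `V_*(s) = Σ_{λ ∈ Λ} m(λ) V(λ s)` for `s > 0` and every normalized `V` (the lattice sums
  (1) converge for `s > 0`, `IsNormalized.summable`), as a `HasSum`/`tsum` over the subtype `Λ`.
* `Theil2006.tsum_weight_mul_m_le` with `summable_weight_mul_m`, `summable_quadForm_rpow`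
  (and `hasSum_weight_mul_m`, `tsum_quadForm_rpow_eq`) — **(35)** with `C = 2`:
  `Σ_{λ ∈ Λ∖{1}} ((1 + log λ) λ⁻⁵ + λ⁻³) m(λ) ≤ 2 Σ_{k ∈ ℤ²∖{0}} (k · (2 1; 1 2) k)^{-3/2}` and both
  series converge (`log λ ≤ λ - 1`, so the weight is `≤ 2 λ⁻³ m(λ)`, and
  `Σ_λ λ⁻³ m(λ) = ⅙ Σ_{ξ ≠ 0} |ξ|⁻³`, `Σ_{k ≠ 0} (k · M k)^{-3/2} = (2√2)⁻¹ Σ_{ξ ≠ 0} |ξ|⁻³`; the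
  lattice `p`-series `Theil2006.summable_norm_triPoint_sub_rpow` of `Theil2006Decay.lean`).
-/

noncomputable section

open scoped BigOperators Topology
open Filter Set Matrix

namespace Literature.MathematicalPhysics.StatisticalMechanics

namespace Theil2006

/-! ## Shells of `A₂` and the multiplicities `m(λ)` -/

/-- The shell of `A₂ ∖ {0}` at distance `λ`, in labels: `{k ≠ 0 : |triPoint k| = λ}`
(`= A₂ ∩ {|η| = λ}` of (21) for `λ > 0`). [cite: Theil2006, §2.3 (21) (preprint p. 8)] -/
def shell (lam : ℝ) : Set (ℤ × ℤ) := {k | k ≠ 0 ∧ ‖triPoint k‖ = lam}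

/-- Membership in a shell. [cite: Theil2006, §2.3 (21) (preprint p. 8)] -/
@[simp] theorem mem_shell {lam : ℝ} {k : ℤ × ℤ} : k ∈ shell lam ↔ k ≠ 0 ∧ ‖triPoint k‖ = lam :=
  Iff.rfl

/-- Every shell is finite (`|triPoint k| → ∞` along the cofinite filter).
[cite: Theil2006, §2.3 (21) (preprint p. 8)] -/
theorem shell_finite (lam : ℝ) : (shell lam).Finite := by
  have h := tendsto_norm_triPoint_cofinite.eventually (eventually_gt_atTop lam)
  refine (Filter.eventually_cofinite.1 h).subset fun k hk => ?_
  simp only [mem_setOf_eq, not_lt]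
  exact hk.2.le

/-- Shells are finite types. [folklore] -/
instance (lam : ℝ) : Finite (shell lam) := (shell_finite lam).to_subtype

/-- Points of a shell are at distance `≥ 1` (`|ξ| ≥ 1` on `A₂ ∖ {0}`). [folklore] -/
private theorem one_le_of_mem_shell {lam : ℝ} {k : ℤ × ℤ} (hk : k ∈ shell lam) : 1 ≤ lam :=
  hk.2 ▸ one_le_norm_triPoint hk.1

/-- **Theil 2006, (21): the multiplicity `m(λ) = ⅙ #(A₂ ∩ {|η| = λ})`** ("the number of different
`D₆`-invariant sub-lattices of `A₂` with lattice parameter `λ` divided by `λ²`"), defined by the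
first formula of (21); `6 ∣ #shell(λ)` (`six_mul_m`), so nothing is lost in the division.
[cite: Theil2006, §2.3 (21) (preprint p. 8)] -/
def m (lam : ℝ) : ℕ := Nat.card (shell lam) / 6

/-! ### The rotation by `π/3` and the sector decomposition of `A₂ ∖ {0}` -/

/-- The six rotations by multiples of `π/3` of `A₂` in labels (`b₁ ↦ b₂ ↦ b₂ - b₁ ↦ -b₁ ↦ …`):
`rotN j` is the `j`-th power of `(k₁, k₂) ↦ (-k₂, k₁ + k₂)`. [folklore] -/
def rotN : Fin 6 → ℤ × ℤ → ℤ × ℤ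
  | 0, k => k
  | 1, k => (-k.2, k.1 + k.2)
  | 2, k => (-k.1 - k.2, k.1)
  | 3, k => (-k.1, -k.2)
  | 4, k => (k.2, -k.1 - k.2)
  | 5, k => (k.1 + k.2, -k.1)

/-- `rotN` is an action of `ℤ/6`: `rotN i (rotN j k) = rotN (i + j) k`. [folklore] -/
private theorem rotN_rotN (i j : Fin 6) (k : ℤ × ℤ) : rotN i (rotN j k) = rotN (i + j) k := by
  obtain ⟨a, b⟩ := k
  fin_cases i <;> fin_cases j <;> simp [rotN] <;> omega

/-- `rotN 0` is the identity. [folklore] -/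
private theorem rotN_zero (k : ℤ × ℤ) : rotN 0 k = k := rfl

/-- The rotations preserve the norm form `k₁² + k₁k₂ + k₂²`. [folklore] -/
private theorem normForm_rotN (j : Fin 6) (k : ℤ × ℤ) :
    (rotN j k).1 ^ 2 + (rotN j k).1 * (rotN j k).2 + (rotN j k).2 ^ 2
      = k.1 ^ 2 + k.1 * k.2 + k.2 ^ 2 := by
  obtain ⟨a, b⟩ := k
  fin_cases j <;> simp [rotN] <;> ring

/-- The rotations are isometries of `A₂`: `|triPoint (rotN j k)| = |triPoint k|` (the "simple
geometric consideration" behind (21)). [cite: Theil2006, §2.3 (21) (preprint p. 8)] -/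
theorem norm_triPoint_rotN (j : Fin 6) (k : ℤ × ℤ) : ‖triPoint (rotN j k)‖ = ‖triPoint k‖ := by
  have h1 := norm_triPoint_sq (rotN j k)
  rw [normForm_rotN] at h1
  have h2 := norm_triPoint_sq k
  exact (pow_left_inj₀ (norm_nonneg _) (norm_nonneg _) two_ne_zero).1 (h1.trans h2.symm)

/-- The rotations fix only the origin. [folklore] -/
private theorem rotN_ne_zero {j : Fin 6} {k : ℤ × ℤ} (hk : k ≠ 0) : rotN j k ≠ 0 := by
  intro h
  apply hk
  have h1 := one_le_norm_triPoint hk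
  rw [← norm_triPoint_rotN j, h, map_zero, norm_zero] at h1
  exact absurd h1 (by norm_num)

/-- The fundamental sector `{k₁ ≥ 1, k₂ ≥ 0}` of the rotation action (the lattice points in the
half-open `60°`-cone spanned by `b₁` (included) and `b₂` (excluded)). [folklore] -/
def sector : Set (ℤ × ℤ) := {k | 1 ≤ k.1 ∧ 0 ≤ k.2}

/-- Every non-zero label has a rotate in the sector. [folklore] -/
private theorem exists_rotN_mem_sector {k : ℤ × ℤ} (hk : k ≠ 0) : ∃ j : Fin 6, rotN j k ∈ sector := by
  obtain ⟨a, b⟩ := k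
  have hab : ¬(a = 0 ∧ b = 0) := fun h => hk (by rw [h.1, h.2]; rfl)
  simp only [sector, mem_setOf_eq]
  rcases le_or_gt 1 a with ha | ha <;> rcases le_or_gt 0 b with hb | hb
  · exact ⟨0, by simp [rotN]; omega⟩
  · rcases le_or_gt 0 (a + b) with hab' | hab'
    · exact ⟨1, by simp [rotN]; omega⟩
    · exact ⟨2, by simp [rotN]; omega⟩
  · rcases le_or_gt 1 (a + b) with hab' | hab'
    · exact ⟨5, by simp [rotN]; omega⟩
    · rcases le_or_gt 1 b with hb' | hb'
      · exact ⟨4, by simp [rotN]; omega⟩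
      · exact ⟨3, by simp [rotN]; omega⟩
  · rcases le_or_gt 0 (a + b) with hab' | hab'
    · exact ⟨1, by simp [rotN]; omega⟩
    · rcases lt_or_ge a 0 with ha' | ha'
      · exact ⟨3, by simp [rotN]; omega⟩
      · exact ⟨2, by simp [rotN]; omega⟩

/-- Distinct rotates of the sector are disjoint. [folklore] -/
private theorem rotN_mem_sector_unique {j : Fin 6} {k : ℤ × ℤ} (hk : k ∈ sector)
    (hj : rotN j k ∈ sector) : j = 0 := by
  obtain ⟨a, b⟩ := k
  simp only [sector, mem_setOf_eq] at hk
  fin_cases j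
  · rfl
  all_goals simp [rotN, sector] at hj; omega

/-- Rotates of shell points are shell points. [folklore] -/
private theorem rotN_mem_shell {lam : ℝ} (j : Fin 6) {k : ℤ × ℤ} (hk : k ∈ shell lam) :
    rotN j k ∈ shell lam :=
  ⟨rotN_ne_zero hk.1, by rw [norm_triPoint_rotN]; exact hk.2⟩

/-- **The sector decomposition**: `shell(λ) ≃ (ℤ/6) × (shell(λ) ∩ sector)`, `(j, k) ↦ rotN j k`.
[folklore] -/
private theorem card_shell_eq (lam : ℝ) :
    Nat.card (shell lam) = 6 * Nat.card ↥(shell lam ∩ sector) := by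
  let φ : Fin 6 × ↥(shell lam ∩ sector) → shell lam :=
    fun x => ⟨rotN x.1 x.2.1, rotN_mem_shell x.1 x.2.2.1⟩
  have hφ : Function.Bijective φ := by
    constructor
    · rintro ⟨i, k, hk⟩ ⟨j, k', hk'⟩ h
      simp only [φ, Subtype.mk.injEq] at h
      -- `k = rotN (-i + j) k'`, both in the sector
      have h2 : k = rotN (-i + j) k' := by
        have := congrArg (rotN (-i)) h
        rwa [rotN_rotN, rotN_rotN, neg_add_cancel, rotN_zero] at this
      have hij : -i + j = 0 := rotN_mem_sector_unique hk'.2 (h2 ▸ hk.2)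
      have hji : j = i := by
        have := congrArg (i + ·) hij
        simpa using this
      subst hji
      rw [neg_add_cancel, rotN_zero] at h2
      subst h2
      rfl
    · rintro ⟨k, hk⟩
      obtain ⟨i, hi⟩ := exists_rotN_mem_sector hk.1
      refine ⟨⟨-i, ⟨rotN i k, rotN_mem_shell i hk, hi⟩⟩, ?_⟩
      simp only [φ, rotN_rotN, neg_add_cancel, rotN_zero]
  rw [← Nat.card_eq_of_bijective φ hφ, Nat.card_prod]
  simp

/-- **Theil 2006, (21)**: `6 m(λ) = #(A₂∖{0} ∩ {|η| = λ})` — the count of a shell is divisible by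
`6` (free action of the rotation by `π/3`). [cite: Theil2006, §2.3 (21) (preprint p. 8)] -/
theorem six_mul_m (lam : ℝ) : 6 * m lam = Nat.card (shell lam) := by
  rw [m, card_shell_eq]
  omega

/-- `m(λ)` counts the shell points in the fundamental sector `{k₁ ≥ 1, k₂ ≥ 0}`.
[cite: Theil2006, §2.3 (21) (preprint p. 8)] -/
theorem m_eq_card_sector (lam : ℝ) : m lam = Nat.card ↥(shell lam ∩ sector) := by
  rw [m, card_shell_eq]
  omega

/-- **Theil 2006, (21), first form**: `m(λ) = ⅙ #(A₂∖{0} ∩ {|η| = λ})` as a real number.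
[cite: Theil2006, §2.3 (21) (preprint p. 8)] -/
theorem m_eq_card_div (lam : ℝ) : (m lam : ℝ) = Nat.card (shell lam) / 6 := by
  rw [← six_mul_m]; push_cast; ring

/-- The quadratic form `k · (2 1; 1 2) k` of (21) and (35) on `ℤ²`.
[cite: Theil2006, §2.3 (21) (preprint p. 8)] -/
def quadForm (k : ℤ × ℤ) : ℤ := ![k.1, k.2] ⬝ᵥ (!![2, 1; 1, 2] *ᵥ ![k.1, k.2])

/-- `k · (2 1; 1 2) k = 2 (k₁² + k₁k₂ + k₂²)`. [cite: Theil2006, §2.3 (21) (preprint p. 8)] -/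
theorem quadForm_eq (k : ℤ × ℤ) : quadForm k = 2 * (k.1 ^ 2 + k.1 * k.2 + k.2 ^ 2) := by
  simp [quadForm, Matrix.mulVec, dotProduct, Fin.sum_univ_two]
  ring

/-- `k · (2 1; 1 2) k = 2 |triPoint k|²` (`A₂ = ½ (2 1; 0 √3) ℤ²`).
[cite: Theil2006, §2.3 (21) (preprint p. 8)] -/
theorem quadForm_eq_two_mul_norm_sq (k : ℤ × ℤ) : (quadForm k : ℝ) = 2 * ‖triPoint k‖ ^ 2 := by
  rw [quadForm_eq, norm_triPoint_sq]; push_cast; ring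

/-- **Theil 2006, (21), second form**: for `λ > 0`,
`A₂ ∩ {|η| = λ} = {k ∈ ℤ² | k · (2 1; 1 2) k = 2λ²}` (in labels; the origin is excluded on both
sides automatically). [cite: Theil2006, §2.3 (21) (preprint p. 8)] -/
theorem shell_eq_quadForm {lam : ℝ} (hlam : 0 < lam) :
    shell lam = {k : ℤ × ℤ | (quadForm k : ℝ) = 2 * lam ^ 2} := by
  ext k
  simp only [mem_shell, mem_setOf_eq, quadForm_eq_two_mul_norm_sq]
  constructor
  · rintro ⟨-, h⟩
    rw [h]
  · intro h
    have h' : ‖triPoint k‖ ^ 2 = lam ^ 2 := by linarith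
    have hn : ‖triPoint k‖ = lam := (pow_left_inj₀ (norm_nonneg _) hlam.le two_ne_zero).1 h'
    refine ⟨fun hk => ?_, hn⟩
    rw [hk, map_zero, norm_zero] at hn
    exact hlam.ne' hn.symm

/-- Shell membership at `λ = √n` through the norm form: `k₁² + k₁k₂ + k₂² = n`. [folklore] -/
private theorem mem_shell_sqrt_iff {n : ℕ} (hn : 0 < n) {k : ℤ × ℤ} :
    k ∈ shell (√n) ↔ k.1 ^ 2 + k.1 * k.2 + k.2 ^ 2 = n := by
  have hs : (0 : ℝ) < √n := Real.sqrt_pos.2 (by exact_mod_cast hn)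
  rw [shell_eq_quadForm hs, mem_setOf_eq, quadForm_eq, Real.sq_sqrt (by positivity)]
  push_cast
  constructor
  · intro h
    have h' : ((k.1 : ℝ) ^ 2 + k.1 * k.2 + k.2 ^ 2) = n := by linarith
    exact_mod_cast h'
  · intro h
    have h' : ((k.1 : ℝ) ^ 2 + k.1 * k.2 + k.2 ^ 2) = n := by exact_mod_cast h
    linarith

/-- **"e.g. `m(1) = 1`"**: the unit shell has six points, one in the sector.
[cite: Theil2006, §2.3 (21) (preprint p. 8)] -/
theorem m_one : m 1 = 1 := by
  rw [m_eq_card_sector]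
  have h : shell 1 ∩ sector = {((1, 0) : ℤ × ℤ)} := by
    ext ⟨a, b⟩
    simp only [mem_inter_iff, sector, mem_setOf_eq, mem_singleton_iff, Prod.mk.injEq]
    have e : shell 1 = shell (√(1 : ℕ)) := by simp
    rw [e, mem_shell_sqrt_iff one_pos]
    push_cast
    constructor
    · rintro ⟨h, ha, hb⟩
      have hb' : b ≤ 0 := by nlinarith
      have hb0 : b = 0 := le_antisymm hb' hb
      subst hb0
      constructor <;> nlinarith
    · rintro ⟨rfl, rfl⟩
      norm_num
  rw [h, Nat.card_coe_set_eq, ncard_singleton]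

/-- **"e.g. `m(√7) = 2`"**: the shell at distance `√7` has twelve points, `(1,2)` and `(2,1)` in the
sector. [cite: Theil2006, §2.3 (21) (preprint p. 8)] -/
theorem m_sqrt_seven : m (√7) = 2 := by
  rw [m_eq_card_sector]
  have h : shell (√7) ∩ sector = {((1, 2) : ℤ × ℤ), (2, 1)} := by
    ext ⟨a, b⟩
    simp only [mem_inter_iff, sector, mem_setOf_eq, mem_insert_iff, mem_singleton_iff,
      Prod.mk.injEq]
    have e : shell (√7) = shell (√(7 : ℕ)) := by simp
    rw [e, mem_shell_sqrt_iff (by norm_num)]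
    push_cast
    constructor
    · rintro ⟨h, ha, hb⟩
      have ha' : a ≤ 2 := by nlinarith
      have hb' : b ≤ 2 := by nlinarith
      interval_cases a <;> interval_cases b <;> simp at h ⊢
    · rintro (⟨rfl, rfl⟩ | ⟨rfl, rfl⟩) <;> norm_num
  rw [h, Nat.card_coe_set_eq, ncard_pair (by decide)]

/-! ## The distance set `Λ` -/

/-- **Theil 2006, `Λ = {λ > 0 | m(λ) ≠ 0}`** — "the countable set … of distances" of `A₂`.
[cite: Theil2006, §2.3 (21)–(22) (preprint p. 8)] -/
def distSet : Set ℝ := {lam | 0 < lam ∧ m lam ≠ 0}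

/-- `m(λ) ≠ 0` iff the shell at distance `λ` is non-empty. [cite: Theil2006, §2.3 (21) (preprint p. 8)] -/
theorem m_ne_zero_iff {lam : ℝ} : m lam ≠ 0 ↔ (shell lam).Nonempty := by
  have h6 := six_mul_m lam
  constructor
  · intro hm
    have hc : Nat.card (shell lam) ≠ 0 := by omega
    exact Set.nonempty_coe_sort.1 (Nat.card_ne_zero.1 hc).1
  · intro hne
    have hc : Nat.card (shell lam) ≠ 0 := Nat.card_ne_zero.2 ⟨hne.to_subtype, inferInstance⟩
    omega

/-- **"`Λ` is the set of distances"**: `λ ∈ Λ ↔ λ = |ξ|` for some `ξ ∈ A₂ ∖ {0}`.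
[cite: Theil2006, §2.3 (21)–(22) (preprint p. 8)] -/
theorem mem_distSet_iff {lam : ℝ} : lam ∈ distSet ↔ ∃ k : ℤ × ℤ, k ≠ 0 ∧ ‖triPoint k‖ = lam := by
  constructor
  · rintro ⟨-, h⟩
    obtain ⟨k, hk⟩ := m_ne_zero_iff.1 h
    exact ⟨k, hk.1, hk.2⟩
  · rintro ⟨k, hk0, hk⟩
    have hmem : k ∈ shell lam := ⟨hk0, hk⟩
    exact ⟨lt_of_lt_of_le one_pos (one_le_of_mem_shell hmem), m_ne_zero_iff.2 ⟨k, hmem⟩⟩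

/-- `Λ ⊂ [1, ∞)`. [cite: Theil2006, §2.3 (21) (preprint p. 8)] -/
theorem one_le_of_mem_distSet {lam : ℝ} (h : lam ∈ distSet) : 1 ≤ lam := by
  obtain ⟨k, hk0, rfl⟩ := mem_distSet_iff.1 h
  exact one_le_norm_triPoint hk0

/-- `1 ∈ Λ` (the nearest-neighbour distance). [cite: Theil2006, §2.3 (21) (preprint p. 8)] -/
theorem one_mem_distSet : (1 : ℝ) ∈ distSet :=
  ⟨one_pos, by rw [m_one]; exact one_ne_zero⟩

/-- `Λ ∖ {1} ⊂ [√3, ∞)`: the second shell of `A₂` has radius `√3`.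
[cite: Theil2006, §2.3 (21) (preprint p. 8)] -/
theorem sqrt_three_le_of_mem_distSet {lam : ℝ} (h : lam ∈ distSet) (h1 : lam ≠ 1) : √3 ≤ lam := by
  obtain ⟨k, hk0, rfl⟩ := mem_distSet_iff.1 h
  exact sqrt_three_le_norm_triPoint hk0 fun hk => h1 (norm_triPoint_of_mem_unitShell hk)

/-- `Λ` is countable. [cite: Theil2006, §2.3 (21)–(22) (preprint p. 8)] -/
theorem distSet_countable : distSet.Countable := by
  refine (Set.countable_range fun k : ℤ × ℤ => ‖triPoint k‖).mono fun lam h => ?_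
  obtain ⟨k, -, hk⟩ := mem_distSet_iff.1 h
  exact ⟨k, hk⟩

/-! ## Regrouping lattice sums by shells; (22) -/

/-- **Regrouping by shells.** If `Σ_{ξ ∈ A₂∖{0}} F(|ξ|) = a` (an unconditionally convergent sum over
the labels `k ≠ 0`), then `Σ_{λ} #shell(λ) F(λ) = a`, the sum running over all `λ ∈ ℝ` (the terms
vanish off `Λ`). [cite: Theil2006, §2.3 (22) (preprint p. 8)] -/
theorem hasSum_card_shell_mul {F : ℝ → ℝ} {a : ℝ}
    (h : HasSum (fun k : {k : ℤ × ℤ // k ≠ 0} => F ‖triPoint k.1‖) a) :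
    HasSum (fun lam : ℝ => (Nat.card (shell lam) : ℝ) * F lam) a := by
  have h1 := h.tsum_fiberwise fun k : {k : ℤ × ℤ // k ≠ 0} => ‖triPoint k.1‖
  refine h1.congr_fun fun lam => ?_
  have h2 : ∀ b : ↥((fun k : {k : ℤ × ℤ // k ≠ 0} => ‖triPoint k.1‖) ⁻¹' {lam}),
      F ‖triPoint b.1.1‖ = F lam := fun b => by
    have hb : ‖triPoint b.1.1‖ = lam := b.2
    rw [hb]
  rw [tsum_congr h2, tsum_const, nsmul_eq_mul]
  congr 2
  exact Nat.card_congr (Equiv.subtypeSubtypeEquivSubtypeInter (fun k : ℤ × ℤ => k ≠ 0)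
    fun k => ‖triPoint k‖ = lam).symm

/-- **Regrouping by shells, over `Λ`.** If `Σ_{ξ ∈ A₂∖{0}} F(|ξ|) = a`, then
`Σ_{λ ∈ Λ} 6 m(λ) F(λ) = a`. [cite: Theil2006, §2.3 (22) (preprint p. 8)] -/
theorem hasSum_shells {F : ℝ → ℝ} {a : ℝ}
    (h : HasSum (fun k : {k : ℤ × ℤ // k ≠ 0} => F ‖triPoint k.1‖) a) :
    HasSum (fun lam : distSet => 6 * (m lam : ℝ) * F lam) a := by
  have h1 := hasSum_card_shell_mul h
  have hsupp : Function.support (fun lam : ℝ => (Nat.card (shell lam) : ℝ) * F lam) ⊆ distSet := by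
    intro lam hlam
    rw [Function.mem_support] at hlam
    have hc : Nat.card (shell lam) ≠ 0 := fun h0 => hlam (by rw [h0]; simp)
    have hm : m lam ≠ 0 := by have := six_mul_m lam; omega
    obtain ⟨k, hk⟩ := m_ne_zero_iff.1 hm
    exact ⟨lt_of_lt_of_le one_pos (one_le_of_mem_shell hk), hm⟩
  have h2 := (hasSum_subtype_iff_of_support_subset hsupp).2 h1
  refine h2.congr_fun fun lam => ?_
  simp only [Function.comp_apply, ← six_mul_m]
  push_cast
  ring

/-- **Theil 2006, (22)**: `V_*(s) = Σ_{λ ∈ Λ} m(λ) V(λ s)` — the renormalized potential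
`V_*(s) = ⅙ Σ_{ξ ∈ A₂∖{0}} V(s|ξ|)` regrouped by shells, for every normalized `V` (its lattice
sums converge for `s > 0`) and `s > 0`, as a `HasSum` over the countable index set `Λ`.
[cite: Theil2006, §2.3 (22) (preprint p. 8)] -/
theorem IsNormalized.hasSum_renormalizedPotential {V : ℝ → ℝ} (hV : IsNormalized V) {s : ℝ}
    (hs : 0 < s) :
    HasSum (fun lam : distSet => (m lam : ℝ) * V (lam * s)) (renormalizedPotential V s) := by
  have h0 : HasSum (fun k : {k : ℤ × ℤ // k ≠ 0} => V (s * ‖triPoint k.1‖)) (latticeSum V s) :=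
    (hV.summable s hs).hasSum
  have h1 := (hasSum_shells (F := fun lam => V (s * lam)) h0).div_const 6
  refine h1.congr_fun fun lam => ?_
  rw [mul_comm (lam : ℝ) s]
  ring

/-- **Theil 2006, (22)** as an identity of sums: `V_*(s) = Σ'_{λ ∈ Λ} m(λ) V(λ s)` (`s > 0`,
`V` normalized). [cite: Theil2006, §2.3 (22) (preprint p. 8)] -/
theorem IsNormalized.renormalizedPotential_eq_tsum {V : ℝ → ℝ} (hV : IsNormalized V) {s : ℝ}
    (hs : 0 < s) :
    renormalizedPotential V s = ∑' lam : distSet, (m lam : ℝ) * V (lam * s) :=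
  (hV.hasSum_renormalizedPotential hs).tsum_eq.symm

/-! ## (35): the weights of the error terms are summable -/

/-- `Σ_{ξ ∈ A₂} |ξ|⁻³ < ∞` (the lattice `p`-series at `s = -3`; junk `0` at `ξ = 0`). [folklore] -/
private theorem summable_norm_triPoint_inv_pow_three :
    Summable fun k : ℤ × ℤ => ‖triPoint k‖⁻¹ ^ 3 := by
  refine (summable_norm_triPoint_sub_rpow 0 (by norm_num : (-3 : ℝ) < -2)).congr fun k => ?_
  rw [sub_zero, Real.rpow_neg (norm_nonneg _), inv_pow]
  norm_cast

/-- `(k · (2 1; 1 2) k)^{-3/2} = (2√2)⁻¹ |triPoint k|⁻³` for `k ≠ 0` (`k · M k = 2|triPoint k|²`).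
[cite: Theil2006, §2.4 (35) (preprint p. 11)] -/
theorem quadForm_rpow_eq {k : ℤ × ℤ} (hk : k ≠ 0) :
    (quadForm k : ℝ) ^ (-(3 / 2 : ℝ)) = (2 * √2)⁻¹ * ‖triPoint k‖⁻¹ ^ 3 := by
  set n := ‖triPoint k‖ with hn_def
  have hn : 0 < n := lt_of_lt_of_le one_pos (one_le_norm_triPoint hk)
  have hq : 0 < 2 * n ^ 2 := by positivity
  rw [quadForm_eq_two_mul_norm_sq, Real.rpow_neg hq.le, show (3 / 2 : ℝ) = 1 + 1 / 2 by norm_num,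
    Real.rpow_add hq, Real.rpow_one, ← Real.sqrt_eq_rpow, Real.sqrt_mul' _ (sq_nonneg n),
    Real.sqrt_sq hn.le, inv_pow, ← mul_inv]
  congr 1
  ring

/-- **Theil 2006, (35), "`< ∞`"**: `Σ_{k ∈ ℤ²∖{0}} (k · (2 1; 1 2) k)^{-3/2} < ∞`.
[cite: Theil2006, §2.4 (35) (preprint p. 11)] -/
theorem summable_quadForm_rpow :
    Summable fun k : {k : ℤ × ℤ // k ≠ 0} => (quadForm k.1 : ℝ) ^ (-(3 / 2 : ℝ)) := by
  have h := (summable_norm_triPoint_inv_pow_three.subtype {k : ℤ × ℤ | k ≠ 0}).mul_left (2 * √2)⁻¹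
  refine h.congr fun k => ?_
  simp only [Function.comp_apply]
  exact (quadForm_rpow_eq k.2).symm

/-- `Σ_{k ≠ 0} (k · M k)^{-3/2} = (2√2)⁻¹ Σ_{k ≠ 0} |triPoint k|⁻³`.
[cite: Theil2006, §2.4 (35) (preprint p. 11)] -/
theorem tsum_quadForm_rpow_eq :
    ∑' k : {k : ℤ × ℤ // k ≠ 0}, (quadForm k.1 : ℝ) ^ (-(3 / 2 : ℝ))
      = (2 * √2)⁻¹ * ∑' k : {k : ℤ × ℤ // k ≠ 0}, ‖triPoint k.1‖⁻¹ ^ 3 := by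
  rw [← tsum_mul_left]
  exact tsum_congr fun k => quadForm_rpow_eq k.2

/-- The weight of (35) at a distance `n ≥ 1` is `≤ 2 n⁻³` (`log n ≤ n - 1`). [folklore] -/
private theorem weight_le {n : ℝ} (hn : 1 ≤ n) :
    (1 + Real.log n) * n⁻¹ ^ 5 + n⁻¹ ^ 3 ≤ 2 * n⁻¹ ^ 3 := by
  have hn0 : 0 < n := by linarith
  have hi0 : 0 ≤ n⁻¹ := inv_nonneg.2 hn0.le
  have hi1 : n⁻¹ ≤ 1 := inv_le_one_of_one_le₀ hn
  have hlog : Real.log n ≤ n - 1 := Real.log_le_sub_one_of_pos hn0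
  have h1 : (1 + Real.log n) * n⁻¹ ^ 5 ≤ n * n⁻¹ ^ 5 :=
    mul_le_mul_of_nonneg_right (by linarith) (pow_nonneg hi0 5)
  have h2 : n * n⁻¹ ^ 5 = n⁻¹ ^ 4 := by field_simp
  have h3 : n⁻¹ ^ 4 ≤ n⁻¹ ^ 3 := pow_le_pow_of_le_one hi0 hi1 (by norm_num)
  linarith

/-- The weight of (35) is non-negative at distances `n ≥ 1`. [folklore] -/
private theorem weight_nonneg {n : ℝ} (hn : 1 ≤ n) :
    0 ≤ (1 + Real.log n) * n⁻¹ ^ 5 + n⁻¹ ^ 3 := by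
  have hi0 : 0 ≤ n⁻¹ := inv_nonneg.2 (by linarith)
  have hlog : 0 ≤ Real.log n := Real.log_nonneg hn
  positivity

/-- The summand of (35), extended by the same formula to all `λ ∈ ℝ` (it vanishes off `Λ`), is
non-negative. [cite: Theil2006, §2.4 (35) (preprint p. 11)] -/
theorem weight_mul_m_nonneg (lam : ℝ) :
    0 ≤ ((1 + Real.log lam) * lam⁻¹ ^ 5 + lam⁻¹ ^ 3) * m lam := by
  by_cases hm : m lam = 0
  · rw [hm]; simp
  · obtain ⟨k, hk⟩ := m_ne_zero_iff.1 hm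
    exact mul_nonneg (weight_nonneg (one_le_of_mem_shell hk)) (Nat.cast_nonneg _)

/-- The pulled-back weights `⅙ w(|ξ|)`, `ξ ∈ A₂ ∖ {0}`, are summable (`w(n) ≤ 2 n⁻³`).
[cite: Theil2006, §2.4 (35) (preprint p. 11)] -/
private theorem summable_weight_norm_triPoint :
    Summable fun k : {k : ℤ × ℤ // k ≠ 0} =>
      ((1 + Real.log ‖triPoint k.1‖) * ‖triPoint k.1‖⁻¹ ^ 5 + ‖triPoint k.1‖⁻¹ ^ 3) / 6 := by
  have h3 : Summable fun k : {k : ℤ × ℤ // k ≠ 0} => ‖triPoint k.1‖⁻¹ ^ 3 :=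
    summable_norm_triPoint_inv_pow_three.subtype {k : ℤ × ℤ | k ≠ 0}
  refine (h3.mul_left (1 / 3)).of_nonneg_of_le (fun k => ?_) (fun k => ?_)
  · exact div_nonneg (weight_nonneg (one_le_norm_triPoint k.2)) (by norm_num)
  · have := weight_le (one_le_norm_triPoint k.2)
    linarith

/-- **Theil 2006, (35), regrouped**: `Σ_λ ((1 + log λ) λ⁻⁵ + λ⁻³) m(λ) = ⅙ Σ_{ξ ∈ A₂∖{0}} w(|ξ|)`,
the sum over all `λ ∈ ℝ` (terms vanish off `Λ`). [cite: Theil2006, §2.4 (35) (preprint p. 11)] -/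
theorem hasSum_weight_mul_m :
    HasSum (fun lam : ℝ => ((1 + Real.log lam) * lam⁻¹ ^ 5 + lam⁻¹ ^ 3) * m lam)
      (∑' k : {k : ℤ × ℤ // k ≠ 0},
        ((1 + Real.log ‖triPoint k.1‖) * ‖triPoint k.1‖⁻¹ ^ 5 + ‖triPoint k.1‖⁻¹ ^ 3) / 6) := by
  have h := hasSum_card_shell_mul
    (F := fun n => ((1 + Real.log n) * n⁻¹ ^ 5 + n⁻¹ ^ 3) / 6)
    summable_weight_norm_triPoint.hasSum
  refine h.congr_fun fun lam => ?_
  rw [← six_mul_m]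
  push_cast
  ring

/-- **Theil 2006, (35), "`< ∞`" for the left-hand side**: the weights
`((1 + log λ) λ⁻⁵ + λ⁻³) m(λ)` are summable over `Λ ∖ {1}`.
[cite: Theil2006, §2.4 (35) (preprint p. 11)] -/
theorem summable_weight_mul_m :
    Summable fun lam : ↥(distSet \ {1}) =>
      ((1 + Real.log (lam : ℝ)) * (lam : ℝ)⁻¹ ^ 5 + (lam : ℝ)⁻¹ ^ 3) * m lam :=
  hasSum_weight_mul_m.summable.subtype _

/-- `√2 ≤ 2`. [folklore] -/
private theorem sqrt_two_le_two : √2 ≤ (2 : ℝ) := by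
  rw [Real.sqrt_le_left (by norm_num)]
  norm_num

/-- **Theil 2006, (35)** with `C = 2`:
`Σ_{λ ∈ Λ∖{1}} ((1 + log λ) λ⁻⁵ + λ⁻³) m(λ) ≤ 2 Σ_{k ∈ ℤ²∖{0}} (k · (2 1; 1 2) k)^{-3/2}`
(both sides finite: `summable_weight_mul_m`, `summable_quadForm_rpow`). Proof: regroup the
left-hand side (even over all of `Λ`) as `⅙ Σ_{ξ ≠ 0} w(|ξ|)` (`hasSum_weight_mul_m`), bound
`w(n) ≤ 2 n⁻³`, and `Σ_{ξ ≠ 0} |ξ|⁻³ = 2√2 Σ_k (k · M k)^{-3/2}`.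
[cite: Theil2006, §2.4 (35) (preprint p. 11)] -/
theorem tsum_weight_mul_m_le :
    ∑' lam : ↥(distSet \ {1}), ((1 + Real.log (lam : ℝ)) * (lam : ℝ)⁻¹ ^ 5 + (lam : ℝ)⁻¹ ^ 3) * m lam
      ≤ 2 * ∑' k : {k : ℤ × ℤ // k ≠ 0}, (quadForm k.1 : ℝ) ^ (-(3 / 2 : ℝ)) := by
  have h3 : Summable fun k : {k : ℤ × ℤ // k ≠ 0} => ‖triPoint k.1‖⁻¹ ^ 3 :=
    summable_norm_triPoint_inv_pow_three.subtype {k : ℤ × ℤ | k ≠ 0}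
  set S₃ := ∑' k : {k : ℤ × ℤ // k ≠ 0}, ‖triPoint k.1‖⁻¹ ^ 3 with hS₃
  have hS₃0 : 0 ≤ S₃ := tsum_nonneg fun k => pow_nonneg (inv_nonneg.2 (norm_nonneg _)) 3
  have hT : ∑' k : {k : ℤ × ℤ // k ≠ 0},
      ((1 + Real.log ‖triPoint k.1‖) * ‖triPoint k.1‖⁻¹ ^ 5 + ‖triPoint k.1‖⁻¹ ^ 3) / 6
        ≤ ∑' k : {k : ℤ × ℤ // k ≠ 0}, 1 / 3 * ‖triPoint k.1‖⁻¹ ^ 3 :=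
    summable_weight_norm_triPoint.tsum_le_tsum
      (fun k => by have := weight_le (one_le_norm_triPoint k.2); linarith) (h3.mul_left _)
  rw [tsum_mul_left] at hT
  calc ∑' lam : ↥(distSet \ {1}),
        ((1 + Real.log (lam : ℝ)) * (lam : ℝ)⁻¹ ^ 5 + (lam : ℝ)⁻¹ ^ 3) * m lam
      ≤ ∑' lam : ℝ, ((1 + Real.log lam) * lam⁻¹ ^ 5 + lam⁻¹ ^ 3) * m lam :=
        Summable.tsum_subtype_le _ _ weight_mul_m_nonneg hasSum_weight_mul_m.summable
    _ = _ := hasSum_weight_mul_m.tsum_eq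
    _ ≤ 1 / 3 * S₃ := hT
    _ ≤ S₃ / √2 := by
        rw [show 1 / 3 * S₃ = S₃ / 3 by ring]
        exact div_le_div_of_nonneg_left hS₃0 (by positivity) (by linarith [sqrt_two_le_two])
    _ = 2 * ∑' k : {k : ℤ × ℤ // k ≠ 0}, (quadForm k.1 : ℝ) ^ (-(3 / 2 : ℝ)) := by
        rw [tsum_quadForm_rpow_eq, ← hS₃]
        field_simp

end Theil2006

end Literature.MathematicalPhysics.StatisticalMechanics
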